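import Summits.Schanuel.Schanuel.Theorems.RootDecomp1KDarkHeights

/-!
# RootDecomp1KTorsionSubst — §21 REV C «TORSION CELLS» port, part 1/5 (lens 6, gen 10 = ROUND 5 theorem round of route-Schanuel-RootDecomp1K on A₄ʰ stmt-Schanuel-33363)

Mechanical port (census-1 gen 8; tools tools/build_dark.py over census/tools/gen7/portkit2.py) of §21 of HOME/decomp-schanuel-lens-6/g10/addendum/TorsionCells.lean v2 (= scratch/Tor21.lean without its copied toolkit)
(sha256 b430567a…, 9025 l; critic VERDICT 2026-08-30T16:25:54Z ACCEPTED — amended F2⁗-1K (i) MET by the sub-class «torsion anchor»; census C-6) on top of the §17 wave Theorems/RootDecomp1KHyper01…19.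
This part: node lines 7859–8186 (24 declarations: algebraicIndependent_of_forall_int, le_totient_sq_aux, le_two_mul_totient_sq, lt_totient_of_le, totient_le_natDegree_of_aeval_eq_zero, torCo …).
No named fact, no hypothesis (only tree-proved inputs);
statements and proofs
are otherwise the node's verbatim, in the wave namespace `Summit.Schanuel.Schanuel.Theorems.RootDecomp1KHyper` (sub-namespace `HyperCell`).
`--supports stmt-Schanuel-33363` (A₄ʰ HyperLiouvilleSchanuel: HYPOTHESIS-FREE decided n = 3 cells (2πi, ρ·2πi, w) and every torsion anchor s·πi (ρ hyper-Liouville), via algebraicIndependent_torsion — only input the tree-proved NW96 Thm 2(2) measure of π). Sorry-free; standard axioms. Nothing here proves Schanuel; rung 0.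
-/

set_option linter.dupNamespace false
set_option linter.unusedSectionVars false

noncomputable section

open Complex IntermediateField Filter Polynomial

namespace Summit.Schanuel.Schanuel.Theorems.RootDecomp1KHyper

variable {n K : ℕ}

namespace HyperCell

variable {n K : ℕ}

/-- No non-trivial integer relation ⇒ algebraically independent over `ℚ`. -/
theorem algebraicIndependent_of_forall_int {n : ℕ} {θ : Fin n → ℂ}
    (h : ∀ G : MvPolynomial (Fin n) ℤ, G ≠ 0 → MvPolynomial.aeval θ G ≠ 0) :
    AlgebraicIndependent ℚ θ := by
  rw [algebraicIndependent_iff]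
  intro g hg
  obtain ⟨N, G, hN, hG⟩ := exists_int_mul_eq_map g
  by_contra hg0
  have hG0 : G ≠ 0 := by
    intro h0
    rw [h0, map_zero, eq_comm, mul_eq_zero] at hG
    rcases hG with h | h
    · exact hN (by exact_mod_cast (MvPolynomial.C_eq_zero.mp h))
    · exact hg0 h
  have hval : MvPolynomial.aeval θ G = 0 := by
    rw [← mvaeval_int_map θ G, hG, map_mul, hg, mul_zero]
  exact h G hG0 hval

/-- §21. TORSION CELLS: (ρ, π, e^{2πiρ}) algebraically independent for hyper-Liouville ρ: auxiliary statement `le_totient_sq_aux` (lens 6 gen 10 node, ported verbatim). -/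
theorem le_totient_sq_aux (n : ℕ) :
    (Odd n → n ≤ n.totient ^ 2) ∧ n ≤ 2 * n.totient ^ 2 := by
  induction n using Nat.recOnPosPrimePosCoprime with
  | prime_pow p k hp hk =>
    rw [Nat.totient_prime_pow hp hk]
    have hp2 := hp.two_le
    rcases Nat.eq_or_lt_of_le hp2 with h2 | h3
    · -- p = 2
      subst h2
      refine ⟨fun hodd => ?_, ?_⟩
      · exfalso
        exact (Nat.not_even_iff_odd.mpr hodd) (Nat.even_pow.mpr ⟨even_two, hk.ne'⟩)
      · have e : (2 : ℕ) ^ k = 2 * 2 ^ (k - 1) := by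
          rw [← pow_succ']; congr 1; omega
        rw [e]
        have h1 : 1 ≤ 2 ^ (k - 1) := Nat.one_le_two_pow
        simp only [Nat.add_one_sub_one, mul_one]
        nlinarith
    · -- p odd prime ≥ 3
      have hb : 2 ≤ p - 1 := by omega
      have ha : 1 ≤ p ^ (k - 1) := Nat.one_le_pow _ _ hp.pos
      have hmain : p ^ k ≤ (p ^ (k - 1) * (p - 1)) ^ 2 := by
        have e : p ^ k = p ^ (k - 1) * p := by
          rw [← pow_succ]; congr 1; omega
        rw [e]
        obtain ⟨b, hbdef⟩ : ∃ b, p - 1 = b := ⟨_, rfl⟩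
        have hpb : p = b + 1 := by omega
        obtain ⟨a, hadef⟩ : ∃ a, p ^ (k - 1) = a := ⟨_, rfl⟩
        rw [hbdef, hadef]
        rw [hadef] at ha
        rw [hbdef] at hb
        rw [hpb]
        have h1 : b + 1 ≤ b * b := by nlinarith
        have h2 : a * (b + 1) ≤ a * (b * b) := Nat.mul_le_mul_left _ h1
        have h3 : a * (b * b) ≤ (a * a) * (b * b) := Nat.mul_le_mul_right _ (Nat.le_mul_self a)
        calc a * (b + 1) ≤ (a * a) * (b * b) := h2.trans h3
          _ = (a * b) ^ 2 := by ring
      exact ⟨fun _ => hmain, hmain.trans (Nat.le_mul_of_pos_left _ (by norm_num))⟩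
  | zero => simp
  | one => simp
  | coprime a b ha hb hab iha ihb =>
    rw [Nat.totient_mul hab, mul_pow]
    refine ⟨fun hodd => ?_, ?_⟩
    · obtain ⟨hoa, hob⟩ := Nat.odd_mul.mp hodd
      exact Nat.mul_le_mul (iha.1 hoa) (ihb.1 hob)
    · -- one of `a`, `b` is odd
      rcases Nat.even_or_odd a with hea | hoa
      · have hob : Odd b := by
          rcases Nat.even_or_odd b with heb | hob
          · exfalso
            have h2 : 2 ∣ Nat.gcd a b := Nat.dvd_gcd (even_iff_two_dvd.mp hea) (even_iff_two_dvd.mp heb)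
            rw [hab] at h2
            omega
          · exact hob
        calc a * b ≤ (2 * a.totient ^ 2) * b.totient ^ 2 := Nat.mul_le_mul iha.2 (ihb.1 hob)
          _ = 2 * (a.totient ^ 2 * b.totient ^ 2) := by ring
      · calc a * b ≤ a.totient ^ 2 * (2 * b.totient ^ 2) := Nat.mul_le_mul (iha.1 hoa) ihb.2
          _ = 2 * (a.totient ^ 2 * b.totient ^ 2) := by ring

/-- §21. TORSION CELLS: (ρ, π, e^{2πiρ}) algebraically independent for hyper-Liouville ρ: auxiliary statement `le_two_mul_totient_sq` (lens 6 gen 10 node, ported verbatim). -/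
theorem le_two_mul_totient_sq (n : ℕ) : n ≤ 2 * n.totient ^ 2 := (le_totient_sq_aux n).2

/-- `φ(q) > b` as soon as `q > 2 b²`… precisely `2 (b+1)² ≤ q`. -/
theorem lt_totient_of_le {b q : ℕ} (hq : 2 * (b + 1) ^ 2 ≤ q) : b < q.totient := by
  by_contra h
  push Not at h
  have h1 := le_two_mul_totient_sq q
  have h2 : 2 * q.totient ^ 2 ≤ 2 * b ^ 2 := by gcongr
  nlinarith

/-- §21b. Primitive roots of large order satisfy no low-degree rational relation: auxiliary statement `totient_le_natDegree_of_aeval_eq_zero` (lens 6 gen 10 node, ported verbatim). -/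
theorem totient_le_natDegree_of_aeval_eq_zero {q : ℕ} (hq : 0 < q) {b : ℂ} (hb : IsPrimitiveRoot b q)
    {g : ℤ[X]} (hg : g ≠ 0) (hgb : aeval b g = 0) : q.totient ≤ g.natDegree := by
  have hmin : minpoly ℚ b = cyclotomic q ℚ := (cyclotomic_eq_minpoly_rat hb hq).symm
  set g' : ℚ[X] := g.map (Int.castRingHom ℚ) with hg'
  have hg'0 : g' ≠ 0 := (Polynomial.map_ne_zero_iff (Int.castRingHom ℚ).injective_int).mpr hg
  have hg'b : aeval b g' = 0 := by
    rw [hg', ← algebraMap_int_eq, aeval_map_algebraMap]; exact hgb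
  have hdeg := minpoly.degree_le_of_ne_zero ℚ b hg'0 hg'b
  rw [hmin] at hdeg
  have h1 : (cyclotomic q ℚ).natDegree ≤ g'.natDegree := natDegree_le_natDegree hdeg
  rw [natDegree_cyclotomic] at h1
  rwa [hg', natDegree_map_eq_of_injective (Int.castRingHom ℚ).injective_int] at h1

section Subst

variable (P : MvPolynomial (Fin 3) ℤ) (D : ℕ) (p : ℤ) (q : ℕ)

/-- homogenised coefficient `c_s p^{s₀} q^{D − s₀}` -/
def torCo (s : Fin 3 →₀ ℕ) : ℤ := P.coeff s * p ^ (s 0) * (q : ℤ) ^ (D - s 0)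

/-- `G_k(X) = Σ_{s : s₁ = k} c_s p^{s₀} q^{D−s₀} X^{s₂}` (the `T^k`-coefficient of `q^D P(p/q, T, X)`). -/
def torG (K : ℕ) (k : Fin (K + 1)) : ℤ[X] :=
  ∑ s ∈ P.support with s 1 = (k : ℕ), C (torCo P D p q s) * X ^ (s 2)

/-- §21c. The substituted relation q^D P(p/q, T, b) as a family G_k ∈ ℤ[b]: auxiliary statement `aeval_torG` (lens 6 gen 10 node, ported verbatim). -/
theorem aeval_torG (K : ℕ) (k : Fin (K + 1)) (b : ℂ) :
    aeval b (torG P D p q K k) =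
      ∑ s ∈ P.support with s 1 = (k : ℕ), ((torCo P D p q s : ℤ) : ℂ) * b ^ (s 2) := by
  unfold torG
  rw [map_sum]
  refine Finset.sum_congr rfl fun s _ => ?_
  rw [map_mul, map_pow, aeval_X, aeval_C, algebraMap_int_eq, eq_intCast]

/-- §21c. The substituted relation q^D P(p/q, T, b) as a family G_k ∈ ℤ[b]: auxiliary statement `natDegree_torG_le` (lens 6 gen 10 node, ported verbatim). -/
theorem natDegree_torG_le (K : ℕ) {N : ℕ} (hN : ∀ s ∈ P.support, s 2 ≤ N) (k : Fin (K + 1)) :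
    (torG P D p q K k).natDegree ≤ N := by
  unfold torG
  refine natDegree_sum_le_of_forall_le _ _ fun s hs => ?_
  exact (natDegree_C_mul_X_pow_le _ _).trans (hN s (Finset.mem_filter.mp hs).1)

/-- §21c. The substituted relation q^D P(p/q, T, b) as a family G_k ∈ ℤ[b]: auxiliary statement `coeff_torG` (lens 6 gen 10 node, ported verbatim). -/
theorem coeff_torG (K : ℕ) (k : Fin (K + 1)) (j : ℕ) :
    (torG P D p q K k).coeff j =
      ∑ s ∈ P.support with s 1 = (k : ℕ), if s 2 = j then torCo P D p q s else 0 := by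
  unfold torG
  rw [finsetSum_coeff]
  refine Finset.sum_congr rfl fun s _ => ?_
  rw [coeff_C_mul_X_pow]
  by_cases h : s 2 = j
  · rw [if_pos h, if_pos h.symm]
  · rw [if_neg h, if_neg (Ne.symm h)]

/-- §21c. The substituted relation q^D P(p/q, T, b) as a family G_k ∈ ℤ[b]: auxiliary statement `torCo_cast_eq` (lens 6 gen 10 node, ported verbatim). -/
theorem torCo_cast_eq (hq : q ≠ 0) {s : Fin 3 →₀ ℕ} (hs : s 0 ≤ D) :
    ((torCo P D p q s : ℤ) : ℂ) = (q : ℂ) ^ D * (((P.coeff s : ℤ) : ℂ) * ((p : ℂ) / q) ^ (s 0)) := by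
  unfold torCo
  push_cast
  have hqC : (q : ℂ) ≠ 0 := by exact_mod_cast hq
  have hsplit : (q : ℂ) ^ D = (q : ℂ) ^ (s 0) * (q : ℂ) ^ (D - s 0) := by
    rw [← pow_add, Nat.add_sub_cancel' hs]
  rw [hsplit, div_pow]
  field_simp

/-- **The substituted relation.** `Σ_k G_k(b) T₀^k = q^D · P(p/q, T₀, b)`. -/
theorem eval_conjFactor_torG {K : ℕ} (hD : ∀ s ∈ P.support, s 0 ≤ D)
    (hK : ∀ s ∈ P.support, s 1 ≤ K) (hq : q ≠ 0) (b T₀ : ℂ) :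
    (conjFactor (torG P D p q K) b).eval T₀ =
      (q : ℂ) ^ D * MvPolynomial.aeval ![((p : ℂ) / q), T₀, b] P := by
  rw [eval_conjFactor]
  simp_rw [aeval_torG, Finset.sum_mul, Finset.sum_filter]
  rw [Finset.sum_comm]
  rw [MvPolynomial.aeval_def, MvPolynomial.eval₂_eq', Finset.mul_sum]
  refine Finset.sum_congr rfl fun s hs => ?_
  -- the inner sum over `k : Fin (K+1)` picks out `k = s 1`
  have hlt : s 1 < K + 1 := Nat.lt_succ_of_le (hK s hs)
  rw [Fin.sum_univ_eq_sum_range (fun k => if s 1 = k then ((torCo P D p q s : ℤ) : ℂ) * b ^ (s 2) * T₀ ^ k else 0) (K + 1)]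
  rw [Finset.sum_ite_eq, if_pos (Finset.mem_range.mpr hlt)]
  rw [Fin.prod_univ_three]
  simp only [algebraMap_int_eq, eq_intCast, Matrix.cons_val_zero, Matrix.cons_val_one,
    Matrix.cons_val]
  rw [torCo_cast_eq P D p q hq (hD s hs)]
  ring

variable {P}

/-- the `(k*, j*)`-slice `d(X') = Σ_{s : s₁ = k*, s₂ = j*} c_s X'^{s₀} ∈ ℤ[X']` -/
def torD (P : MvPolynomial (Fin 3) ℤ) (k j : ℕ) : ℤ[X] :=
  ∑ s ∈ P.support with (s 1 = k ∧ s 2 = j), monomial (s 0) (P.coeff s)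

/-- §21d. Non-vanishing of the substituted relation at primitive roots of large order: auxiliary statement `finsupp_fin3_ext` (lens 6 gen 10 node, ported verbatim). -/
private theorem finsupp_fin3_ext {s t : Fin 3 →₀ ℕ} (h0 : s 0 = t 0) (h1 : s 1 = t 1) (h2 : s 2 = t 2) :
    s = t := by
  ext i
  fin_cases i
  · exact h0
  · exact h1
  · exact h2

/-- §21d. Non-vanishing of the substituted relation at primitive roots of large order: auxiliary statement `coeff_torD` (lens 6 gen 10 node, ported verbatim). -/
theorem coeff_torD (P : MvPolynomial (Fin 3) ℤ) (k j i : ℕ) :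
    (torD P k j).coeff i =
      ∑ s ∈ P.support with (s 1 = k ∧ s 2 = j), if s 0 = i then P.coeff s else 0 := by
  unfold torD
  rw [finsetSum_coeff]
  refine Finset.sum_congr rfl fun s _ => ?_
  rw [coeff_monomial]

/-- §21d. Non-vanishing of the substituted relation at primitive roots of large order: auxiliary statement `torD_ne_zero` (lens 6 gen 10 node, ported verbatim). -/
theorem torD_ne_zero {s₀ : Fin 3 →₀ ℕ} (hs₀ : s₀ ∈ P.support) : torD P (s₀ 1) (s₀ 2) ≠ 0 := by
  intro h0
  have hc := coeff_torD P (s₀ 1) (s₀ 2) (s₀ 0)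
  rw [h0, coeff_zero] at hc
  rw [Finset.sum_eq_single s₀] at hc
  · rw [if_pos rfl] at hc
    exact (MvPolynomial.mem_support_iff.mp hs₀) hc.symm
  · intro s hs hne
    rw [if_neg]
    intro h
    obtain ⟨-, h1, h2⟩ := Finset.mem_filter.mp hs
    exact hne (finsupp_fin3_ext h h1 h2)
  · intro h
    exact absurd (Finset.mem_filter.mpr ⟨hs₀, rfl, rfl⟩) h

/-- `(G_{k*}).coeff j* = q^D · d(p/q)` (in `ℚ`). -/
theorem coeff_torG_eq_torD {K : ℕ} (hD : ∀ s ∈ P.support, s 0 ≤ D) (hq : q ≠ 0)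
    (k : Fin (K + 1)) (j : ℕ) :
    (((torG P D p q K k).coeff j : ℤ) : ℚ) =
      (q : ℚ) ^ D * aeval ((p : ℚ) / q) (torD P k j) := by
  rw [coeff_torG, torD, map_sum, Finset.mul_sum]
  push_cast
  rw [Finset.sum_filter, Finset.sum_filter]
  refine Finset.sum_congr rfl fun s hs => ?_
  by_cases h1 : s 1 = (k : ℕ)
  · rw [if_pos h1]
    by_cases h2 : s 2 = j
    · rw [if_pos h2, if_pos ⟨h1, h2⟩, aeval_monomial, algebraMap_int_eq, eq_intCast]
      unfold torCo
      push_cast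
      have hqQ : (q : ℚ) ≠ 0 := by exact_mod_cast hq
      have hsplit : (q : ℚ) ^ D = (q : ℚ) ^ (s 0) * (q : ℚ) ^ (D - s 0) := by
        rw [← pow_add, Nat.add_sub_cancel' (hD s hs)]
      rw [hsplit, div_pow]
      field_simp
    · rw [if_neg h2, if_neg (fun h => h2 h.2)]
  · rw [if_neg h1, if_neg (fun h => h1 h.1)]

/-- a bound for the denominators of the rational roots of `d` -/
def denBound (d : ℤ[X]) : ℕ := ((d.map (Int.castRingHom ℚ)).roots.toFinset.sup Rat.den) + 1

/-- §21d. Non-vanishing of the substituted relation at primitive roots of large order: auxiliary statement `den_lt_denBound` (lens 6 gen 10 node, ported verbatim). -/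
theorem den_lt_denBound {d : ℤ[X]} (hd : d ≠ 0) {r : ℚ} (hr : aeval r d = 0) : r.den < denBound d := by
  unfold denBound
  have hd' : d.map (Int.castRingHom ℚ) ≠ 0 :=
    (Polynomial.map_ne_zero_iff (Int.castRingHom ℚ).injective_int).mpr hd
  have hmem : r ∈ (d.map (Int.castRingHom ℚ)).roots.toFinset := by
    rw [Multiset.mem_toFinset, mem_roots hd', IsRoot.def, eval_map, ← algebraMap_int_eq, ← aeval_def]
    exact hr
  exact Nat.lt_succ_of_le (Finset.le_sup (f := Rat.den) hmem)

/-- **Non-vanishing.** For `q` beyond the rational-root denominators of `d` and with `φ(q) > N`,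
no conjugate factor `P(p/q, T, b)` (`b` a primitive `q`-th root of unity) is the zero polynomial. -/
theorem conjFactor_torG_ne_zero {K N : ℕ} (hD : ∀ s ∈ P.support, s 0 ≤ D)
    (hN : ∀ s ∈ P.support, s 2 ≤ N) {s₀ : Fin 3 →₀ ℕ} (hs₀ : s₀ ∈ P.support) (hs₀K : s₀ 1 ≤ K)
    (r : ℚ) (hp : p = r.num) (hq : q = r.den)
    (hq1 : denBound (torD P (s₀ 1) (s₀ 2)) ≤ q) (hq2 : 2 * (N + 1) ^ 2 ≤ q)
    {b : ℂ} (hb : IsPrimitiveRoot b q) : conjFactor (torG P D p q K) b ≠ 0 := by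
  have hq0 : q ≠ 0 := by rw [hq]; exact r.den_nz
  intro h0
  set k : Fin (K + 1) := ⟨s₀ 1, Nat.lt_succ_of_le hs₀K⟩ with hk
  have hcoef : aeval b (torG P D p q K k) = 0 := by
    have := coeff_conjFactor (torG P D p q K) b k
    rw [h0, coeff_zero] at this
    exact this.symm
  by_cases hG : torG P D p q K k = 0
  · -- then `d(p/q) = 0`: `q` is below the denominator bound
    have h1 := coeff_torG_eq_torD D p q hD hq0 k (s₀ 2)
    rw [hG, coeff_zero, Int.cast_zero, eq_comm, mul_eq_zero] at h1
    have hqQ : (q : ℚ) ^ D ≠ 0 := pow_ne_zero _ (by exact_mod_cast hq0)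
    have h2 : aeval ((p : ℚ) / q) (torD P (s₀ 1) (s₀ 2)) = 0 := (or_iff_right hqQ).mp h1
    have hr : ((p : ℚ) / q) = r := by rw [hp, hq]; exact Rat.num_div_den r
    rw [hr] at h2
    have := den_lt_denBound (torD_ne_zero hs₀) h2
    omega
  · -- else `φ(q) ≤ deg G_k ≤ N < φ(q)`
    have h1 := totient_le_natDegree_of_aeval_eq_zero (Nat.pos_of_ne_zero hq0) hb hG hcoef
    have h2 := natDegree_torG_le P D p q K hN k
    have h3 := lt_totient_of_le hq2
    omega

end Subst

/-- §21e. resPoly non-vanishing from non-vanishing conjugate factors: auxiliary statement `resPoly_ne_zero'` (lens 6 gen 10 node, ported verbatim). -/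
theorem resPoly_ne_zero' (f : ℤ[X]) (hf : f ≠ 0) (G : Fin (K + 1) → ℤ[X]) {N : ℕ}
    (hN : ∀ k, (G k).natDegree ≤ N)
    (hne : ∀ b ∈ (f.map (Int.castRingHom ℂ)).roots, conjFactor G b ≠ 0) :
    resPoly f G N ≠ 0 := by
  intro h0
  have h := map_resPoly f G hN
  rw [h0, Polynomial.map_zero] at h
  have hlc : (f.map (Int.castRingHom ℂ)).leadingCoeff ^ N ≠ 0 :=
    pow_ne_zero _ (leadingCoeff_ne_zero.mpr
      ((Polynomial.map_ne_zero_iff (RingHom.injective_int _)).mpr hf))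
  have hprod : ((f.map (Int.castRingHom ℂ)).roots.map (conjFactor G)).prod ≠ 0 := by
    apply Multiset.prod_ne_zero
    intro hmem
    obtain ⟨b, hb, hb0⟩ := Multiset.mem_map.mp hmem
    exact hne b hb hb0
  exact (mul_ne_zero (C_ne_zero.mpr hlc) hprod) h.symm

/-- §21f. Cyclotomic data in ℂ: auxiliary statement `roots_cyclotomic_map` (lens 6 gen 10 node, ported verbatim). -/
theorem roots_cyclotomic_map {q : ℕ} (hq : 0 < q) :
    ((cyclotomic q ℤ).map (Int.castRingHom ℂ)).roots = (primitiveRoots q ℂ).val := by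
  haveI : NeZero (q : ℂ) := ⟨by exact_mod_cast hq.ne'⟩
  rw [map_cyclotomic_int, cyclotomic.roots_eq_primitiveRoots_val]

/-- §21f. Cyclotomic data in ℂ: auxiliary statement `mahlerMeasure_cyclotomic_map` (lens 6 gen 10 node, ported verbatim). -/
theorem mahlerMeasure_cyclotomic_map {q : ℕ} (hq : 0 < q) :
    ((cyclotomic q ℤ).map (Int.castRingHom ℂ)).mahlerMeasure = 1 := by
  rw [mahlerMeasure_eq_leadingCoeff_mul_prod_roots, roots_cyclotomic_map hq, map_cyclotomic_int,
    (cyclotomic.monic q ℂ).leadingCoeff, norm_one, one_mul]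
  refine Multiset.prod_eq_one fun x hx => ?_
  obtain ⟨b, hb, rfl⟩ := Multiset.mem_map.mp hx
  have hb' : IsPrimitiveRoot b q := (mem_primitiveRoots hq).mp (Finset.mem_def.mpr hb)
  rw [hb'.norm'_eq_one hq.ne', max_self]

/-- `e^{2πi p/q}` is a primitive `q`-th root of unity for `p/q` in lowest terms. -/
theorem isPrimitiveRoot_exp_rat (r : ℚ) :
    IsPrimitiveRoot (cexp (2 * Real.pi * I * (r : ℂ))) r.den := by
  have hq : r.den ≠ 0 := r.den_nz
  have h1 := (Complex.isPrimitiveRoot_exp r.den hq).zpow_of_gcd_eq_one r.num (by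
    show r.num.natAbs.gcd (r.den : ℤ).natAbs = 1
    rw [Int.natAbs_natCast]; exact r.reduced)
  have e : cexp (2 * Real.pi * I / r.den) ^ r.num = cexp (2 * Real.pi * I * (r : ℂ)) := by
    rw [← Complex.exp_int_mul]
    congr 1
    rw [Rat.cast_def]
    ring
  rwa [e] at h1

end HyperCell

end Summit.Schanuel.Schanuel.Theorems.RootDecomp1KHyper
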